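/-
Public-audit package `pub-balaban` (b2b-balaban), surge lineage pv26, gen 11.
Released under the Apache 2.0 licence, like Mathlib.
-/
import Literature.MathematicalPhysics.QuantumFieldTheory.Balaban1983to89.T4CubeChartExp
import Literature.MathematicalPhysics.QuantumFieldTheory.Balaban1983to89.T4CubeConvexExtension
import Mathlib.Analysis.SpecialFunctions.Trigonometric.EulerSineProd
import Mathlib.Analysis.SpecialFunctions.Trigonometric.Series
import Mathlib.Analysis.Analytic.OfScalars
import Mathlib.NumberTheory.ZetaValues

/-!
# T4 — the exponential cube chart: smoothness and the Hessian floor `2/3` of its Jacobian (JAC)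

Kernel certificate, tags **[folklore]** throughout (0 `cite`): every statement below is PROVED here from
Mathlib and from the already-landed leaves `T4CubeChartExp` (the exponential cube chart of `SU(2)^s`,
its window and the product Jacobian `expJac`) and `T4CubeConvexExtension` (local Hessian bounds
`HessianBoundOn`, the saturation map `satMap`, and the local tilt/response plug
`mem_respDom_of_cubeChart_local`).  Nothing printed is asserted and nothing minted internally is cited.
VALUE = a kernel-checked certificate about the chart; it is NOT summit progress and it does NOT size any
constant of the Bałaban programme (see the caveats).

## What is proved

Write a block `v ∈ ℝ³` of the chart coordinates and `q(v) = Σᵢ vᵢ²`.  The single-block log-Jacobian of the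
exponential chart is `ρ(v) = expLogWeight v = −log((2π²)⁻¹ sinc²‖v‖)` (`T4CubeChartExp`).

* §1 `ps` — the EVEN POWER SERIES of `sinc`: `P(t) = Σₙ (−1)ⁿ tⁿ/(2n+1)!`, an entire function with
  `Real.sinc r = P(r²)` (`sinc_eq_ps`), `P > 0` on `[0, π²)`, `ContDiff ℝ ⊤ P`.  (Mathlib's `Real.sinc` API has
  no smoothness lemma and `‖·‖` is not smooth at `0`; the even series is the way around both.)
* §2 the EULER PRODUCT in the variable `t = r²`: `P(t) = lim_N ∏_{j<N} (1 − t/a_j)`, `a_j = (j+1)²π²`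
  (from `Real.tendsto_euler_sin_prod`), the factor profile `g_a(u) = −2 log(1 − u/a) − 2u/a` (convex on
  `(-∞, a)`, monotone on `[0, a)`), and `Σ_j 1/a_j = 1/6` (from `hasSum_zeta_two`); hence for `0 ≤ u < π²`
  `log(2π²) + Σ_{j<N} g_{a_j}(u) ⟶ log(2π²) − 2 log P(u) − u/3`.
* §3 generic convexity helpers: outer-monotone-convex composition, finite sums, pointwise limits, and
  `hessianBoundOn_of_convexOn` — a `C²` function `f` with `f − (λ/2)|x|²` convex on an OPEN set `U` has
  `HessianBoundOn f U λ` (second derivative of a convex slice is `≥ 0`).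
* §4 `convexOn_expLogWeight_sub` — **`ρ(v) − q(v)/3` is convex on the ball `{q < π²}`**, as a pointwise limit of
  the convex functions `log(2π²) + Σ_{j<N} g_{a_j}(q(v))` (each summand = convex monotone profile ∘ convex `q`);
  summed over blocks, `expJac − (1/3)|x|²` is convex on the chart domain `chartDom` (every block in the ball),
  and `expJac` is smooth there.
* §5 the GLOBAL `C²` REPRESENTATIVE `expJacRep = expJac ∘ satMap S₁ S₂` (equal to `expJac` on `cube n S₁`),
  `HessianBoundOn expJacRep (cube n S') (2/3)` whenever `S' < S₁ < S₂`, `0 ≤ S₂`, `3 S₂² < π²`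
  (`hessianBoundOn_expJacRep`), and the plug `mem_respDom_of_expChart_local`: the exponential-chart twin of
  `T4CubeConvexExtension.mem_respDom_of_gnoChart_local` with modulus `2/3 + μ` under `3 S'² < π²`.

## Caveats (read before citing this file anywhere)

* (RADIUS) everything is local to cubes with `3 S'² < π²`, the injectivity radius of the exponential chart
  inherited from `T4CubeChartExp`; nothing is claimed at or beyond `|v| = π`, where `log sinc²` is singular.
* (FLOOR) `2/3` is the Hessian floor of ONE block's `ρ` on the whole ball `{q < π²}`; it is the value of the
  Hessian of `ρ` at the centre (orientation only, UNTYPED here), so it cannot be improved on any cube.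
* (RANK) `SU(2)` blocks only (`Fin 3` coordinates per bond); no `SU(N)`, `N ≥ 3`.
* (γ NOT SIZED) the plug takes the Hessian data `μ, b_H, L` of the tilt/insertions as HYPOTHESES; this file
  sizes none of them and says nothing about which window the printed programme uses (`T4CubeChartExp` (N1)).
* 1-D pointwise-limit convexity already exists as `Balaban1983to89.Missing.convexOn_of_tendsto` (`ℝ → ℝ`);
  §3 re-proves the three-line module version it needs (`E → ℝ`), nothing else is duplicated: the API of the
  two parent leaves is used BY NAME.
-/

noncomputable section

open _root_.MeasureTheory Set Filter
open Function (updateFinset)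
open scoped Topology ContDiff Matrix Nat Real

namespace Literature.MathematicalPhysics.QuantumFieldTheory.Balaban1983to89.T4CubeChartExpHessian

open Literature.Probability.Distributions (coordGradient coordHessian)
open T4CubePoincare T4CubeChartTransport T4CubeChartGnomonic T4CubeChartExp T4CubeConvexExtension
open T4HaarSU2ExpChart (expWeight)
open T4CovarianceResponse (respDom)

/-! ## §1  The even power series of `sinc` -/

/-- The coefficients `cₙ = (−1)ⁿ/(2n+1)!` of the even series of `sinc`. [folklore] -/
def psCoeff (n : ℕ) : ℝ := (-1) ^ n / (2 * n + 1)!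

/-- `P(t) = Σₙ (−1)ⁿ tⁿ/(2n+1)!`, the entire function with `P(r²) = sinc r`. [folklore] -/
def ps : ℝ → ℝ := (FormalMultilinearSeries.ofScalars ℝ psCoeff).sum

/-- `c₀ = 1`. [folklore] -/
theorem psCoeff_zero : psCoeff 0 = 1 := by simp [psCoeff]

/-- No coefficient vanishes. [folklore] -/
theorem psCoeff_ne_zero (n : ℕ) : psCoeff n ≠ 0 := by
  unfold psCoeff
  exact div_ne_zero (pow_ne_zero _ (by norm_num)) (Nat.cast_ne_zero.2 (Nat.factorial_ne_zero _))

/-- `|cₙ| = 1/(2n+1)!`. [folklore] -/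
theorem norm_psCoeff (n : ℕ) : ‖psCoeff n‖ = 1 / (2 * n + 1)! := by
  unfold psCoeff
  rw [norm_div, norm_pow, norm_neg, norm_one, one_pow, Real.norm_natCast]

/-- The coefficient ratio `|cₙ₊₁|/|cₙ| = 1/((2n+2)(2n+3))`. [folklore] -/
theorem norm_psCoeff_succ_div (n : ℕ) :
    ‖psCoeff (n + 1)‖ / ‖psCoeff n‖ = 1 / ((2 * n + 2) * (2 * n + 3)) := by
  rw [norm_psCoeff, norm_psCoeff]
  have h : ((2 * (n + 1) + 1)! : ℝ) = (2 * n + 2) * (2 * n + 3) * (2 * n + 1)! := by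
    rw [show 2 * (n + 1) + 1 = (2 * n + 1 + 1) + 1 by ring, Nat.factorial_succ, Nat.factorial_succ]
    push_cast
    ring
  rw [h]
  have hf : (0 : ℝ) < (2 * n + 1)! := by exact_mod_cast Nat.factorial_pos _
  field_simp

/-- The even series of `sinc` has infinite radius of convergence. [folklore] -/
theorem ps_radius_eq_top : (FormalMultilinearSeries.ofScalars ℝ psCoeff).radius = ⊤ := by
  refine FormalMultilinearSeries.ofScalars_radius_eq_top_of_tendsto ℝ psCoeff
    (Eventually.of_forall psCoeff_ne_zero) ?_
  have h : Tendsto (fun n : ℕ => ((2 * (n : ℝ) + 2) * (2 * n + 3))⁻¹) atTop (𝓝 0) := by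
    refine tendsto_inv_atTop_zero.comp ?_
    have h1 : Tendsto (fun n : ℕ => 2 * (n : ℝ) + 2) atTop atTop :=
      tendsto_atTop_add_const_right _ _ (tendsto_natCast_atTop_atTop.const_mul_atTop two_pos)
    have h2 : Tendsto (fun n : ℕ => 2 * (n : ℝ) + 3) atTop atTop :=
      tendsto_atTop_add_const_right _ _ (tendsto_natCast_atTop_atTop.const_mul_atTop two_pos)
    exact h1.atTop_mul_atTop₀ h2
  refine h.congr fun n => ?_
  show ((2 * (n : ℝ) + 2) * (2 * n + 3))⁻¹ = ‖psCoeff n.succ‖ / ‖psCoeff n‖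
  rw [Nat.succ_eq_add_one, norm_psCoeff_succ_div, one_div]

/-- `P(t) = Σₙ cₙ tⁿ` converges for every real `t`. [folklore] -/
theorem hasSum_ps (t : ℝ) : HasSum (fun n => psCoeff n * t ^ n) (ps t) := by
  have h := (FormalMultilinearSeries.ofScalars ℝ psCoeff).hasSum (x := t)
    (by rw [ps_radius_eq_top]; exact Metric.mem_eball.2 (edist_lt_top _ _))
  show HasSum _ ((FormalMultilinearSeries.ofScalars ℝ psCoeff).sum t)
  simpa [FormalMultilinearSeries.ofScalars_apply_eq, mul_comm] using h

/-- `P(0) = 1`. [folklore] -/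
theorem ps_zero : ps 0 = 1 := by
  have h := hasSum_ps 0
  have h1 : HasSum (fun n => psCoeff n * (0 : ℝ) ^ n) (psCoeff 0 * (0 : ℝ) ^ 0) :=
    hasSum_single 0 fun n hn => by simp [zero_pow hn]
  rw [h.unique h1, psCoeff_zero]
  simp

/-- **`sinc r = P(r²)`.** [folklore] -/
theorem sinc_eq_ps (r : ℝ) : Real.sinc r = ps (r ^ 2) := by
  rcases eq_or_ne r 0 with rfl | hr
  · rw [Real.sinc_zero, zero_pow two_ne_zero, ps_zero]
  · have h1 := (Real.hasSum_sin r).div_const r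
    have hfun : (fun n : ℕ => (-1) ^ n * r ^ (2 * n + 1) / ((2 * n + 1)! : ℝ) / r) =
        fun n => psCoeff n * (r ^ 2) ^ n := by
      funext n
      rw [psCoeff, ← pow_mul, pow_succ]
      field_simp
    rw [hfun] at h1
    rw [Real.sinc_of_ne_zero hr]
    exact h1.unique (hasSum_ps _)

/-- `P(t) = sinc √t` for `t ≥ 0`. [folklore] -/
theorem ps_eq_sinc_sqrt {t : ℝ} (ht : 0 ≤ t) : ps t = Real.sinc (Real.sqrt t) := by
  rw [sinc_eq_ps, Real.sq_sqrt ht]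

/-- `P > 0` on `[0, π²)` (there `P(t) = sin √t/√t`). [folklore] -/
theorem ps_pos {t : ℝ} (ht : 0 ≤ t) (htπ : t < π ^ 2) : 0 < ps t := by
  rw [ps_eq_sinc_sqrt ht]
  have hs : Real.sqrt t < π := (Real.sqrt_lt' Real.pi_pos).2 htπ
  by_cases h0 : Real.sqrt t = 0
  · rw [h0, Real.sinc_zero]; exact one_pos
  · rw [Real.sinc_of_ne_zero h0]
    have hpos : 0 < Real.sqrt t := lt_of_le_of_ne (Real.sqrt_nonneg t) (Ne.symm h0)
    exact div_pos (Real.sin_pos_of_pos_of_lt_pi hpos hs) hpos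

/-- `P` is smooth (indeed analytic) on `ℝ`. [folklore] -/
theorem contDiff_ps {m : WithTop ℕ∞} : ContDiff ℝ m ps := by
  have h := (FormalMultilinearSeries.ofScalars ℝ psCoeff).hasFPowerSeriesOnBall
    (by rw [ps_radius_eq_top]; exact ENNReal.zero_lt_top)
  have ha : AnalyticOnNhd ℝ ps Set.univ := fun t _ =>
    h.analyticAt_of_mem (by rw [ps_radius_eq_top]; exact Metric.mem_eball.2 (edist_lt_top _ _))
  exact ha.contDiff

/-! ## §2  One-dimensional facts: the Euler factors and the Basel constant -/

/-- The Euler factor profile `g_a(u) = −2 log(1 − u/a) − 2u/a`. [folklore] -/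
def gFac (a u : ℝ) : ℝ := -2 * Real.log (1 - u / a) - 2 * u / a

/-- Its derivative `g_a'(u) = 2/(a − u) − 2/a`. [folklore] -/
def gFacD (a u : ℝ) : ℝ := 2 * (a - u)⁻¹ - 2 * a⁻¹

/-- `g_a' = 2/(a−u) − 2/a` on `(-∞, a)` (`a > 0`). [folklore] -/
theorem hasDerivAt_gFac {a u : ℝ} (ha : 0 < a) (hu : u < a) : HasDerivAt (gFac a) (gFacD a u) u := by
  have hne : 1 - u / a ≠ 0 := by
    have : u / a < 1 := (div_lt_one ha).2 hu
    linarith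
  have hau : a - u ≠ 0 := (sub_pos.2 hu).ne'
  have h1 : HasDerivAt (fun u : ℝ => 1 - u / a) (-(1 / a)) u := by
    simpa using ((hasDerivAt_id u).div_const a).const_sub 1
  have h2 := (h1.log hne).const_mul (-2)
  have h3 : HasDerivAt (fun u : ℝ => 2 * u / a) (2 / a) u := by
    simpa using ((hasDerivAt_id u).const_mul 2).div_const a
  show HasDerivAt (fun u => -2 * Real.log (1 - u / a) - 2 * u / a) (gFacD a u) u
  refine (h2.sub h3).congr_deriv ?_
  rw [gFacD]
  field_simp

/-- `g_a'' = 2/(a−u)²` on `(-∞, a)`. [folklore] -/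
theorem hasDerivAt_gFacD {a u : ℝ} (hu : u < a) : HasDerivAt (gFacD a) (2 / (a - u) ^ 2) u := by
  have hau : a - u ≠ 0 := (sub_pos.2 hu).ne'
  have h1 : HasDerivAt (fun u : ℝ => a - u) (-1) u := by
    simpa using (hasDerivAt_id u).const_sub a
  have h2 := ((h1.inv hau).const_mul 2).sub_const (2 * a⁻¹)
  show HasDerivAt (fun u => 2 * (a - u)⁻¹ - 2 * a⁻¹) (2 / (a - u) ^ 2) u
  refine h2.congr_deriv ?_
  rw [neg_neg]
  ring

/-- `g_a` is convex on `(-∞, a)`. [folklore] -/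
theorem convexOn_gFac {a : ℝ} (ha : 0 < a) : ConvexOn ℝ (Set.Iio a) (gFac a) := by
  refine convexOn_of_hasDerivWithinAt2_nonneg (convex_Iio a) (f' := gFacD a)
    (f'' := fun u => 2 / (a - u) ^ 2) ?_ ?_ ?_ ?_
  · exact fun u hu => (hasDerivAt_gFac ha hu).continuousAt.continuousWithinAt
  · exact fun u hu => (hasDerivAt_gFac ha (Set.mem_Iio.1 (interior_subset hu))).hasDerivWithinAt
  · exact fun u hu => (hasDerivAt_gFacD (Set.mem_Iio.1 (interior_subset hu))).hasDerivWithinAt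
  · exact fun u _ => by positivity

/-- `g_a` is monotone on `[0, a)` (`g_a' = 2/(a−u) − 2/a ≥ 0` there). [folklore] -/
theorem monotoneOn_gFac {a : ℝ} (ha : 0 < a) : MonotoneOn (gFac a) (Set.Ico 0 a) := by
  refine monotoneOn_of_deriv_nonneg (convex_Ico 0 a) ?_ ?_ ?_
  · exact fun u hu => (hasDerivAt_gFac ha hu.2).continuousAt.continuousWithinAt
  · exact fun u hu =>
      (hasDerivAt_gFac ha (Set.mem_Ico.1 (interior_subset hu)).2).differentiableAt.differentiableWithinAt
  · intro u hu
    rw [interior_Ico] at hu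
    rw [(hasDerivAt_gFac ha hu.2).deriv, gFacD]
    have : a⁻¹ ≤ (a - u)⁻¹ := inv_anti₀ (sub_pos.2 hu.2) (by linarith [hu.1])
    linarith

/-- The Euler abscissae `a_j = (j+1)² π²`. [folklore] -/
def eulerA (j : ℕ) : ℝ := ((j : ℝ) + 1) ^ 2 * π ^ 2

/-- `a_j > 0`. [folklore] -/
theorem eulerA_pos (j : ℕ) : 0 < eulerA j := by
  unfold eulerA; positivity

/-- `π² ≤ a_j`. [folklore] -/
theorem pi_sq_le_eulerA (j : ℕ) : π ^ 2 ≤ eulerA j := by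
  unfold eulerA
  have h : (1 : ℝ) ≤ ((j : ℝ) + 1) ^ 2 := by nlinarith [j.cast_nonneg (α := ℝ)]
  exact le_mul_of_one_le_left (sq_nonneg π) h

/-- **Euler's product in the variable `t = r²`:** `∏_{j<N} (1 − t/a_j) ⟶ P(t)` for `t ≥ 0`. [folklore] -/
theorem tendsto_eulerProd {t : ℝ} (ht : 0 ≤ t) :
    Tendsto (fun N => ∏ j ∈ Finset.range N, (1 - t / eulerA j)) atTop (𝓝 (ps t)) := by
  rcases ht.eq_or_lt with h0 | htpos
  · subst h0
    simp [ps_zero]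
  · set r := Real.sqrt t with hr
    have hr0 : 0 < r := Real.sqrt_pos.2 htpos
    have hrt : r ^ 2 = t := Real.sq_sqrt ht
    have hx : π * (r / π) = r := by field_simp
    have hE := Real.tendsto_euler_sin_prod (r / π)
    have h2 := hE.const_mul r⁻¹
    have hlim : r⁻¹ * Real.sin (π * (r / π)) = ps t := by
      rw [hx, ps_eq_sinc_sqrt ht, Real.sinc_of_ne_zero hr0.ne', div_eq_inv_mul]
    rw [← hlim]
    refine h2.congr fun N => ?_
    rw [hx, ← mul_assoc, inv_mul_cancel₀ hr0.ne', one_mul]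
    refine Finset.prod_congr rfl fun j _ => ?_
    rw [eulerA, div_pow, hrt, div_div, mul_comm]

/-- `Σ_{j<N} 1/a_j ⟶ 1/6` (Basel). [folklore] -/
theorem tendsto_sum_inv_eulerA :
    Tendsto (fun N => ∑ j ∈ Finset.range N, (eulerA j)⁻¹) atTop (𝓝 (1 / 6)) := by
  have hB : Tendsto (fun N => (π ^ 2)⁻¹ * ∑ i ∈ Finset.range (N + 1), 1 / (i : ℝ) ^ 2) atTop
      (𝓝 ((π ^ 2)⁻¹ * (π ^ 2 / 6))) :=
    (hasSum_zeta_two.tendsto_sum_nat.comp (tendsto_add_atTop_nat 1)).const_mul _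
  have hval : (π ^ 2)⁻¹ * (π ^ 2 / 6) = 1 / 6 := by
    field_simp
  rw [← hval]
  refine hB.congr fun N => ?_
  rw [Finset.sum_range_succ']
  simp only [Nat.cast_zero, ne_eq, OfNat.ofNat_ne_zero, not_false_eq_true, zero_pow, div_zero,
    add_zero, Nat.cast_add, Nat.cast_one]
  rw [Finset.mul_sum]
  refine Finset.sum_congr rfl fun j _ => ?_
  rw [eulerA, mul_inv, one_div, mul_comm]

/-- **The log of the Euler product, recentred:** for `0 ≤ u < π²`,
`log(2π²) + Σ_{j<N} g_{a_j}(u) ⟶ log(2π²) − 2 log P(u) − u/3`. [folklore] -/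
theorem tendsto_logEuler {u : ℝ} (hu0 : 0 ≤ u) (huπ : u < π ^ 2) :
    Tendsto (fun N => Real.log (2 * π ^ 2) + ∑ j ∈ Finset.range N, gFac (eulerA j) u) atTop
      (𝓝 (Real.log (2 * π ^ 2) - 2 * Real.log (ps u) - u / 3)) := by
  have hfac : ∀ j, 0 < 1 - u / eulerA j := fun j => by
    have : u / eulerA j < 1 := (div_lt_one (eulerA_pos j)).2 (huπ.trans_le (pi_sq_le_eulerA j))
    linarith
  have hlog : Tendsto (fun N => ∑ j ∈ Finset.range N, Real.log (1 - u / eulerA j)) atTop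
      (𝓝 (Real.log (ps u))) := by
    have h := (tendsto_eulerProd hu0).log (ps_pos hu0 huπ).ne'
    exact h.congr fun N => Real.log_prod (fun j _ => (hfac j).ne')
  have hB := tendsto_sum_inv_eulerA.const_mul (2 * u)
  have hmain : Tendsto (fun N => Real.log (2 * π ^ 2) +
      (-2) * (∑ j ∈ Finset.range N, Real.log (1 - u / eulerA j)) -
      (2 * u) * ∑ j ∈ Finset.range N, (eulerA j)⁻¹) atTop
      (𝓝 (Real.log (2 * π ^ 2) + (-2) * Real.log (ps u) - (2 * u) * (1 / 6))) :=
    ((hlog.const_mul (-2)).const_add _).sub hB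
  have hval : Real.log (2 * π ^ 2) + (-2) * Real.log (ps u) - (2 * u) * (1 / 6) =
      Real.log (2 * π ^ 2) - 2 * Real.log (ps u) - u / 3 := by ring
  rw [hval] at hmain
  have hterm : ∀ j, gFac (eulerA j) u =
      (-2) * Real.log (1 - u / eulerA j) - (2 * u) * (eulerA j)⁻¹ := fun j => by
    unfold gFac
    ring
  refine hmain.congr fun N => ?_
  rw [Finset.mul_sum, Finset.mul_sum, add_sub_assoc, ← Finset.sum_sub_distrib]
  simp only [hterm]

/-! ## §3  Generic convexity helpers and the convexity ⇒ Hessian-bound lemma -/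

/-- A convex monotone outer function of a convex inner function is convex (with an explicit convex
codomain window `T` for the inner values). [folklore] -/
theorem convexOn_comp_of_monotoneOn {E : Type*} [AddCommGroup E] [Module ℝ E] {s : Set E} {T : Set ℝ}
    {f : E → ℝ} {g : ℝ → ℝ} (hf : ConvexOn ℝ s f) (hg : ConvexOn ℝ T g) (hmono : MonotoneOn g T)
    (hT : Set.MapsTo f s T) : ConvexOn ℝ s (fun x => g (f x)) := by
  refine ⟨hf.1, fun x hx y hy a b ha hb hab => ?_⟩
  have h1 : f (a • x + b • y) ≤ a • f x + b • f y := hf.2 hx hy ha hb hab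
  have hm1 : f (a • x + b • y) ∈ T := hT (hf.1 hx hy ha hb hab)
  have hm2 : a • f x + b • f y ∈ T := hg.1 (hT hx) (hT hy) ha hb hab
  exact (hmono hm1 hm2 h1).trans (hg.2 (hT hx) (hT hy) ha hb hab)

/-- A finite sum of convex functions is convex. [folklore] -/
theorem convexOn_finset_sum {E ι : Type*} [AddCommGroup E] [Module ℝ E] {s : Set E}
    (hs : Convex ℝ s) (t : Finset ι) {f : ι → E → ℝ} (h : ∀ i ∈ t, ConvexOn ℝ s (f i)) :
    ConvexOn ℝ s (fun x => ∑ i ∈ t, f i x) := by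
  classical
  induction t using Finset.induction_on with
  | empty => simpa using convexOn_const (0 : ℝ) hs
  | @insert a t hat ih =>
    have ha' := h a (Finset.mem_insert_self a t)
    have ht' := ih fun i hi => h i (Finset.mem_insert_of_mem hi)
    refine ⟨hs, fun x hx y hy p q hp hq hpq => ?_⟩
    have h1 := ha'.2 hx hy hp hq hpq
    have h2 := ht'.2 hx hy hp hq hpq
    simp only [Finset.sum_insert hat, smul_eq_mul] at h1 h2 ⊢
    linarith

/-- A pointwise limit of convex functions is convex (module version; the `ℝ → ℝ` case is
`Balaban1983to89.Missing.convexOn_of_tendsto`). [folklore] -/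
theorem convexOn_of_tendsto {E : Type*} [AddCommGroup E] [Module ℝ E] {s : Set E} (hs : Convex ℝ s)
    {F : ℕ → E → ℝ} {f : E → ℝ} (hF : ∀ N, ConvexOn ℝ s (F N))
    (hlim : ∀ x ∈ s, Tendsto (fun N => F N x) atTop (𝓝 (f x))) : ConvexOn ℝ s f := by
  refine ⟨hs, fun x hx y hy a b ha hb hab => ?_⟩
  exact le_of_tendsto_of_tendsto' (hlim _ (hs hx hy ha hb hab))
    (((hlim x hx).const_smul a).add ((hlim y hy).const_smul b)) fun N => (hF N).2 hx hy ha hb hab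

/-- The derivative of a function monotone on a neighbourhood is `≥ 0`. [folklore] -/
theorem nonneg_of_hasDerivAt_of_monotoneOn {g : ℝ → ℝ} {T : Set ℝ} {t g' : ℝ} (hT : T ∈ 𝓝 t)
    (hg : MonotoneOn g T) (hd : HasDerivAt g g' t) : 0 ≤ g' := by
  have hacc : AccPt t (𝓟 T) := by
    rw [accPt_principal_iff_nhdsWithin, Set.sdiff_eq,
      nhdsWithin_inter_of_mem (mem_nhdsWithin_of_mem_nhds hT)]
    infer_instance
  exact hd.hasDerivWithinAt.nonneg_of_monotoneOn hacc hg

variable {n : ℕ}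

/-- **Convexity ⇒ Hessian floor.** If `f` is `C²` and `f − (λ/2)|x|²` is convex on an open set `U`, then
`HessianBoundOn f U λ`: along every line the slice of `f − (λ/2)|x|²` is convex, so its derivative is monotone
and its second derivative at the base point, `D²f(x)[w,w] − λ|w|²`, is `≥ 0`. [folklore] -/
theorem hessianBoundOn_of_convexOn {f : (Fin n → ℝ) → ℝ} (hf : ContDiff ℝ 2 f) {U : Set (Fin n → ℝ)}
    (hU : IsOpen U) {lam : ℝ} (hconv : ConvexOn ℝ U fun x => f x - lam / 2 * (x ⬝ᵥ x)) :
    HessianBoundOn f U lam := by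
  rw [hessianBoundOn_iff_fderiv hf]
  intro x hx w
  have hdf : Differentiable ℝ f := hf.differentiable (by norm_num)
  -- the parameter set of the line `t ↦ x + t • w` inside `U`
  have hline_cont : Continuous fun t : ℝ => x + t • w := by fun_prop
  have hT_open : IsOpen ((fun t : ℝ => x + t • w) ⁻¹' U) := hU.preimage hline_cont
  have h0T : (0 : ℝ) ∈ (fun t : ℝ => x + t • w) ⁻¹' U := by simp [hx]
  have hT_nhds : (fun t : ℝ => x + t • w) ⁻¹' U ∈ 𝓝 (0 : ℝ) := hT_open.mem_nhds h0T
  -- the slice is convex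
  have hmap : ∀ t : ℝ, AffineMap.lineMap x (x + w) t = x + t • w := fun t => by
    rw [AffineMap.lineMap_apply_module']
    simp [add_comm]
  have hconvφ : ConvexOn ℝ ((fun t : ℝ => x + t • w) ⁻¹' U)
      (fun t : ℝ => f (x + t • w) - lam / 2 * ((x + t • w) ⬝ᵥ (x + t • w))) := by
    have h := hconv.comp_affineMap (AffineMap.lineMap x (x + w))
    have hset : (⇑(AffineMap.lineMap x (x + w) : ℝ →ᵃ[ℝ] (Fin n → ℝ))) ⁻¹' U =
        (fun t : ℝ => x + t • w) ⁻¹' U := by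
      ext t; simp [hmap]
    have hfun : ((fun x => f x - lam / 2 * (x ⬝ᵥ x)) ∘
        ⇑(AffineMap.lineMap x (x + w) : ℝ →ᵃ[ℝ] (Fin n → ℝ))) =
        fun t : ℝ => f (x + t • w) - lam / 2 * ((x + t • w) ⬝ᵥ (x + t • w)) := by
      funext t; simp [hmap]
    rw [hset, hfun] at h
    exact h
  -- derivative of the slice
  have hline : ∀ t : ℝ, HasDerivAt (fun t : ℝ => x + t • w) w t := fun t => by
    simpa using ((hasDerivAt_id t).smul_const w).const_add x
  have hquad : ∀ t : ℝ, HasDerivAt (fun t : ℝ => (x + t • w) ⬝ᵥ (x + t • w))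
      (2 * ((x + t • w) ⬝ᵥ w)) t := by
    intro t
    have hq : (fun t : ℝ => (x + t • w) ⬝ᵥ (x + t • w)) =
        fun t => x ⬝ᵥ x + 2 * (x ⬝ᵥ w) * t + (w ⬝ᵥ w) * t ^ 2 := by
      funext t
      simp only [add_dotProduct, dotProduct_add, smul_dotProduct, dotProduct_smul, smul_eq_mul,
        dotProduct_comm w x]
      ring
    have hv : 2 * ((x + t • w) ⬝ᵥ w) = 2 * (x ⬝ᵥ w) + (w ⬝ᵥ w) * (2 * t) := by
      simp only [add_dotProduct, smul_dotProduct, smul_eq_mul]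
      ring
    rw [hq, hv]
    have ha : HasDerivAt (fun y : ℝ => 2 * (x ⬝ᵥ w) * y) (2 * (x ⬝ᵥ w)) t := by
      simpa using (hasDerivAt_id t).const_mul (2 * (x ⬝ᵥ w))
    have hb : HasDerivAt (fun y : ℝ => (w ⬝ᵥ w) * y ^ 2) ((w ⬝ᵥ w) * (2 * t)) t := by
      simpa using (hasDerivAt_pow 2 t).const_mul (w ⬝ᵥ w)
    exact (ha.const_add (x ⬝ᵥ x)).add hb
  have hφd : ∀ t : ℝ, HasDerivAt
      (fun t : ℝ => f (x + t • w) - lam / 2 * ((x + t • w) ⬝ᵥ (x + t • w)))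
      (fderiv ℝ f (x + t • w) w - lam * ((x + t • w) ⬝ᵥ w)) t := by
    intro t
    have h1 : HasDerivAt (fun t : ℝ => f (x + t • w)) (fderiv ℝ f (x + t • w) w) t := by
      have := ((hdf (x + t • w)).hasFDerivAt).comp_hasDerivAt t (hline t)
      simpa [Function.comp_def] using this
    have h2 := (hquad t).const_mul (lam / 2)
    refine (h1.sub h2).congr_deriv ?_
    ring
  -- the derivative of the slice is monotone on the parameter set
  have hmono : MonotoneOn (fun t : ℝ => fderiv ℝ f (x + t • w) w - lam * ((x + t • w) ⬝ᵥ w))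
      ((fun t : ℝ => x + t • w) ⁻¹' U) := by
    have hm := hconvφ.monotoneOn_deriv (fun t _ => (hφd t).differentiableAt)
    intro a ha b hb hab
    have := hm ha hb hab
    rwa [(hφd a).deriv, (hφd b).deriv] at this
  -- its derivative at `0` is the Hessian form minus `λ|w|²`
  have hφ'' : HasDerivAt (fun t : ℝ => fderiv ℝ f (x + t • w) w - lam * ((x + t • w) ⬝ᵥ w))
      (fderiv ℝ (fderiv ℝ f) x w w - lam * (w ⬝ᵥ w)) 0 := by
    have h1 := hasDerivAt_fderiv_line hf x w
    have h2 : HasDerivAt (fun t : ℝ => lam * ((x + t • w) ⬝ᵥ w)) (lam * (w ⬝ᵥ w)) 0 := by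
      have hq : (fun t : ℝ => lam * ((x + t • w) ⬝ᵥ w)) =
          fun t => lam * (x ⬝ᵥ w) + lam * (w ⬝ᵥ w) * t := by
        funext t
        simp only [add_dotProduct, smul_dotProduct, smul_eq_mul]
        ring
      rw [hq]
      simpa using ((hasDerivAt_id (0 : ℝ)).const_mul (lam * (w ⬝ᵥ w))).const_add (lam * (x ⬝ᵥ w))
    exact h1.sub h2
  have key := nonneg_of_hasDerivAt_of_monotoneOn hT_nhds hmono hφ''
  linarith

/-! ## §4  The block profile `ρ = ρ₁ ∘ q` and its convexity defect -/

/-- `q(v) = Σᵢ vᵢ²` on a block `ℝ³`. [folklore] -/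
def sqn (v : Fin 3 → ℝ) : ℝ := ∑ i, v i ^ 2

/-- `q ≥ 0`. [folklore] -/
theorem sqn_nonneg (v : Fin 3 → ℝ) : 0 ≤ sqn v := Finset.sum_nonneg fun i _ => sq_nonneg (v i)

/-- `q(v) = ‖v‖²` (Euclidean norm of the block). [folklore] -/
theorem sqn_eq_norm_toE_sq (v : Fin 3 → ℝ) : sqn v = ‖toE v‖ ^ 2 := by
  rw [norm_toE_sq]; rfl

/-- `q` is smooth. [folklore] -/
theorem contDiff_sqn {m : WithTop ℕ∞} : ContDiff ℝ m sqn := by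
  show ContDiff ℝ m fun v : Fin 3 → ℝ => ∑ i, v i ^ 2
  exact ContDiff.sum fun i _ => (contDiff_apply ℝ ℝ i).pow 2

/-- `q` is convex. [folklore] -/
theorem convexOn_sqn : ConvexOn ℝ Set.univ sqn := by
  refine convexOn_finset_sum convex_univ _ (f := fun (i : Fin 3) (v : Fin 3 → ℝ) => v i ^ 2)
    fun i _ => ?_
  refine ⟨convex_univ, fun x _ y _ a b ha hb hab => ?_⟩
  have hb' : b = 1 - a := by linarith
  subst hb'
  simp only [Pi.add_apply, Pi.smul_apply, smul_eq_mul]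
  nlinarith [mul_nonneg (mul_nonneg ha hb) (sq_nonneg (x i - y i))]

/-- The chart ball of one block: `{q < π²}`. [folklore] -/
def chartBall : Set (Fin 3 → ℝ) := {v | sqn v < π ^ 2}

/-- The chart ball is open. [folklore] -/
theorem isOpen_chartBall : IsOpen chartBall :=
  isOpen_lt (contDiff_sqn (m := 0)).continuous continuous_const

/-- The chart ball is convex. [folklore] -/
theorem convex_chartBall : Convex ℝ chartBall := by
  have h := convexOn_sqn.convex_lt (π ^ 2)
  simpa [chartBall] using h

/-- A cube `[-S,S]³` with `3S² < π²` lies in the chart ball. [folklore] -/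
theorem cube_subset_chartBall {S : ℝ} (hSπ : 3 * S ^ 2 < π ^ 2) : cube 3 S ⊆ chartBall := by
  intro v hv
  have h := toE_mem_ball_of_mem_cube hSπ hv
  rw [mem_ball_zero_iff] at h
  show sqn v < π ^ 2
  rw [sqn_eq_norm_toE_sq]
  exact pow_lt_pow_left₀ h (norm_nonneg _) two_ne_zero

/-- `P(q(v)) > 0` on the chart ball. [folklore] -/
theorem ps_sqn_pos {v : Fin 3 → ℝ} (hv : v ∈ chartBall) : 0 < ps (sqn v) :=
  ps_pos (sqn_nonneg v) hv

/-- The radial profile in the variable `t = |v|²`: `ρ₁(t) = −log((2π²)⁻¹ P(t)²)`. [folklore] -/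
def rho1 (t : ℝ) : ℝ := -Real.log ((2 * π ^ 2)⁻¹ * ps t ^ 2)

/-- **`w_exp(v) = (2π²)⁻¹ P(q(v))²`** — the exponential-chart weight through the even series. [folklore] -/
theorem expCubeWeight_eq (v : Fin 3 → ℝ) : expCubeWeight v = (2 * π ^ 2)⁻¹ * ps (sqn v) ^ 2 := by
  rw [expCubeWeight, T4HaarSU2ExpChart.expWeight, sinc_eq_ps, ← sqn_eq_norm_toE_sq]

/-- `ρ = ρ₁ ∘ q`. [folklore] -/
theorem expLogWeight_eq (v : Fin 3 → ℝ) : expLogWeight v = rho1 (sqn v) := by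
  rw [expLogWeight, expCubeWeight_eq, rho1]

/-- `ρ₁(t) = log(2π²) − 2 log P(t)` where `P(t) > 0`. [folklore] -/
theorem rho1_eq {t : ℝ} (ht : 0 < ps t) :
    rho1 t = Real.log (2 * π ^ 2) - 2 * Real.log (ps t) := by
  have h2 : (0 : ℝ) < 2 * π ^ 2 := by positivity
  rw [rho1, Real.log_mul (inv_ne_zero h2.ne') (pow_ne_zero _ ht.ne'), Real.log_inv, Real.log_pow]
  push_cast
  ring

/-- `ρ₁` is smooth where `P ≠ 0`. [folklore] -/
theorem contDiffAt_rho1 {t : ℝ} (ht : ps t ≠ 0) {m : WithTop ℕ∞} : ContDiffAt ℝ m rho1 t := by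
  have h : ContDiffAt ℝ m (fun t => (2 * π ^ 2)⁻¹ * ps t ^ 2) t :=
    (contDiff_const.mul (contDiff_ps.pow 2)).contDiffAt
  have h2 : (0 : ℝ) < 2 * π ^ 2 := by positivity
  exact (h.log (mul_ne_zero (inv_ne_zero h2.ne') (pow_ne_zero _ ht))).neg

/-- **The convexity defect of one block: `ρ₁(q(v)) − q(v)/3` is convex on the chart ball `{q < π²}`** —
the pointwise limit of `log(2π²) + Σ_{j<N} g_{a_j}(q(v))`, each summand convex. [folklore] -/
theorem convexOn_rho1_sqn_sub : ConvexOn ℝ chartBall (fun v => rho1 (sqn v) - sqn v / 3) := by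
  have hq : ConvexOn ℝ chartBall sqn := convexOn_sqn.subset (Set.subset_univ _) convex_chartBall
  have hmaps : ∀ j, Set.MapsTo sqn chartBall (Set.Ico 0 (eulerA j)) := fun j v hv =>
    ⟨sqn_nonneg v, lt_of_lt_of_le hv (pi_sq_le_eulerA j)⟩
  have hN : ∀ N : ℕ, ConvexOn ℝ chartBall
      (fun v => Real.log (2 * π ^ 2) + ∑ j ∈ Finset.range N, gFac (eulerA j) (sqn v)) := by
    intro N
    have hsum := convexOn_finset_sum convex_chartBall (Finset.range N)
      (f := fun j v => gFac (eulerA j) (sqn v)) fun j _ =>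
        convexOn_comp_of_monotoneOn hq
          ((convexOn_gFac (eulerA_pos j)).subset Set.Ico_subset_Iio_self (convex_Ico _ _))
          (monotoneOn_gFac (eulerA_pos j)) (hmaps j)
    exact (convexOn_const (Real.log (2 * π ^ 2)) convex_chartBall).add hsum
  refine convexOn_of_tendsto convex_chartBall hN fun v hv => ?_
  show Tendsto _ atTop (𝓝 (rho1 (sqn v) - sqn v / 3))
  rw [rho1_eq (ps_sqn_pos hv)]
  exact tendsto_logEuler (sqn_nonneg v) hv

/-- **`ρ(v) − |v|²/3` is convex on the chart ball.** [folklore] -/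
theorem convexOn_expLogWeight_sub :
    ConvexOn ℝ chartBall (fun v => expLogWeight v - sqn v / 3) := by
  refine convexOn_rho1_sqn_sub.congr fun v _ => ?_
  simp only [expLogWeight_eq]

/-- `ρ` is smooth on the chart ball. [folklore] -/
theorem contDiffAt_expLogWeight {v : Fin 3 → ℝ} (hv : v ∈ chartBall) {m : WithTop ℕ∞} :
    ContDiffAt ℝ m expLogWeight v := by
  have h : expLogWeight = fun v => rho1 (sqn v) := funext expLogWeight_eq
  rw [h]
  exact (contDiffAt_rho1 (ps_sqn_pos hv).ne').comp v contDiff_sqn.contDiffAt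

/-! ### The product Jacobian on the chart domain -/

variable {P : Params} {j : ℕ} {s : Finset (PBond P j)}

/-- The block-extraction linear map `x ↦ (xᵉ⁽ᵇ,ⁱ⁾)ᵢ`. [folklore] -/
def blk (e : ↥s × Fin 3 ≃ Fin n) (b : ↥s) : (Fin n → ℝ) →ₗ[ℝ] (Fin 3 → ℝ) where
  toFun x := fun i => x (e (b, i))
  map_add' _ _ := rfl
  map_smul' _ _ := rfl

/-- `blk e b x = (xᵉ⁽ᵇ,ⁱ⁾)ᵢ`. [folklore] -/
@[simp] theorem blk_apply (e : ↥s × Fin 3 ≃ Fin n) (b : ↥s) (x : Fin n → ℝ) :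
    blk e b x = fun i => x (e (b, i)) := rfl

/-- The chart domain: every block inside the chart ball. [folklore] -/
def chartDom (s : Finset (PBond P j)) (e : ↥s × Fin 3 ≃ Fin n) : Set (Fin n → ℝ) :=
  {x | ∀ b : ↥s, sqn (fun i => x (e (b, i))) < π ^ 2}

/-- The chart domain as a finite intersection of block preimages of the chart ball. [folklore] -/
theorem chartDom_eq (e : ↥s × Fin 3 ≃ Fin n) : chartDom s e = ⋂ b : ↥s, (blk e b) ⁻¹' chartBall := by
  ext x
  simp [chartDom, chartBall]

/-- The chart domain is open. [folklore] -/
theorem isOpen_chartDom (e : ↥s × Fin 3 ≃ Fin n) : IsOpen (chartDom s e) := by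
  rw [chartDom_eq]
  exact isOpen_iInter_of_finite fun b => isOpen_chartBall.preimage
    (show Continuous fun x : Fin n → ℝ => fun i => x (e (b, i)) from
      continuous_pi fun i => continuous_apply (e (b, i)))

/-- The chart domain is convex. [folklore] -/
theorem convex_chartDom (e : ↥s × Fin 3 ≃ Fin n) : Convex ℝ (chartDom s e) := by
  rw [chartDom_eq]
  exact convex_iInter fun b => convex_chartBall.linear_preimage (blk e b)

/-- A cube `[-S,S]ⁿ` with `3S² < π²` lies in the chart domain. [folklore] -/
theorem cube_subset_chartDom (e : ↥s × Fin 3 ≃ Fin n) {S : ℝ} (hSπ : 3 * S ^ 2 < π ^ 2) :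
    cube n S ⊆ chartDom s e :=
  fun _ hx b => cube_subset_chartBall hSπ (block_mem_cube e hx b)

/-- `expJac = Σ_b ρ₁(q(x_b))`. [folklore] -/
theorem expJac_eq (e : ↥s × Fin 3 ≃ Fin n) (x : Fin n → ℝ) :
    expJac s e x = ∑ b : ↥s, rho1 (sqn (fun i => x (e (b, i)))) := by
  simp only [expJac, expLogWeight_eq]

/-- `|x|² = Σ_b q(x_b)` (regrouping the coordinates by blocks). [folklore] -/
theorem dotProduct_self_eq_sum_blocks (e : ↥s × Fin 3 ≃ Fin n) (x : Fin n → ℝ) :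
    x ⬝ᵥ x = ∑ b : ↥s, sqn (fun i => x (e (b, i))) := by
  simp only [dotProduct, sqn, sq]
  rw [← Equiv.sum_comp e (fun k => x k * x k), Fintype.sum_prod_type]

/-- **`expJac − (1/3)|x|²` is convex on the chart domain.** [folklore] -/
theorem convexOn_expJac_sub (e : ↥s × Fin 3 ≃ Fin n) :
    ConvexOn ℝ (chartDom s e) (fun x => expJac s e x - 1 / 3 * (x ⬝ᵥ x)) := by
  have hterm : ∀ b : ↥s, ConvexOn ℝ (chartDom s e)
      (fun x => rho1 (sqn (fun i => x (e (b, i)))) - sqn (fun i => x (e (b, i))) / 3) := by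
    intro b
    have h := convexOn_rho1_sqn_sub.comp_linearMap (blk e b)
    exact h.subset (fun x hx => show sqn (fun i => x (e (b, i))) < π ^ 2 from hx b) (convex_chartDom e)
  have hsum := convexOn_finset_sum (convex_chartDom e) (Finset.univ : Finset ↥s) fun b _ => hterm b
  refine hsum.congr fun x _ => ?_
  show ∑ b : ↥s, (rho1 (sqn (fun i => x (e (b, i)))) - sqn (fun i => x (e (b, i))) / 3) =
    expJac s e x - 1 / 3 * (x ⬝ᵥ x)
  rw [expJac_eq, dotProduct_self_eq_sum_blocks e x, Finset.mul_sum, ← Finset.sum_sub_distrib]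
  exact Finset.sum_congr rfl fun b _ => by ring

/-- `expJac` is smooth on the chart domain. [folklore] -/
theorem contDiffOn_expJac (e : ↥s × Fin 3 ≃ Fin n) {m : WithTop ℕ∞} :
    ContDiffOn ℝ m (expJac s e) (chartDom s e) := by
  intro x hx
  have h : ContDiffAt ℝ m (fun x : Fin n → ℝ => ∑ b : ↥s, expLogWeight (fun i => x (e (b, i)))) x := by
    refine ContDiffAt.sum fun b _ => ?_
    have hin : ContDiffAt ℝ m (fun x : Fin n → ℝ => fun i => x (e (b, i))) x :=
      (contDiff_pi.2 fun i => contDiff_apply ℝ ℝ (e (b, i))).contDiffAt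
    have hcomp := (contDiffAt_expLogWeight (m := m) (hx b)).comp x hin
    exact hcomp
  exact h.contDiffWithinAt

/-! ## §5  The global `C²` representative and the Hessian floor `2/3` -/

/-- The open cube `{|xᵢ| < S}`. [folklore] -/
def openCube (n : ℕ) (S : ℝ) : Set (Fin n → ℝ) := Set.pi Set.univ fun _ => Set.Ioo (-S) S

/-- Membership in the open cube. [folklore] -/
theorem mem_openCube_iff {S : ℝ} {x : Fin n → ℝ} : x ∈ openCube n S ↔ ∀ i, |x i| < S := by
  simp [openCube, abs_lt]

/-- The open cube is open. [folklore] -/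
theorem isOpen_openCube {S : ℝ} : IsOpen (openCube n S) :=
  isOpen_set_pi Set.finite_univ fun _ _ => isOpen_Ioo

/-- The open cube is convex. [folklore] -/
theorem convex_openCube {S : ℝ} : Convex ℝ (openCube n S) :=
  convex_pi fun _ _ => convex_Ioo _ _

/-- `openCube n S ⊆ cube n S`. [folklore] -/
theorem openCube_subset_cube {S : ℝ} : openCube n S ⊆ cube n S :=
  fun _ hx => mem_cube_iff.2 fun i => (mem_openCube_iff.1 hx i).le

/-- `cube n S ⊆ openCube n S'` for `S < S'`. [folklore] -/
theorem cube_subset_openCube {S S' : ℝ} (h : S < S') : cube n S ⊆ openCube n S' :=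
  fun _ hx => mem_openCube_iff.2 fun i => (mem_cube_iff.1 hx i).trans_lt h

/-- **The global `C²` representative** of the exponential-chart Jacobian: `expJac ∘ satMap S₁ S₂`. [folklore] -/
def expJacRep (s : Finset (PBond P j)) (e : ↥s × Fin 3 ≃ Fin n) (S₁ S₂ : ℝ) (x : Fin n → ℝ) : ℝ :=
  expJac s e (satMap S₁ S₂ x)

/-- The representative agrees with `expJac` on `cube n S₁`. [folklore] -/
theorem expJacRep_eq (e : ↥s × Fin 3 ≃ Fin n) {S₁ S₂ : ℝ} (h12 : S₁ < S₂) {x : Fin n → ℝ}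
    (hx : x ∈ cube n S₁) : expJacRep s e S₁ S₂ x = expJac s e x := by
  rw [expJacRep, satMap_eq_self h12 hx]

/-- `satMap S₁ S₂` takes values in the chart domain when `3 S₂² < π²`. [folklore] -/
theorem satMap_mem_chartDom (e : ↥s × Fin 3 ≃ Fin n) {S₁ S₂ : ℝ} (h12 : S₁ < S₂) (h2 : 0 ≤ S₂)
    (hS₂π : 3 * S₂ ^ 2 < π ^ 2) (x : Fin n → ℝ) : satMap S₁ S₂ x ∈ chartDom s e :=
  cube_subset_chartDom e hS₂π (satMap_mem_cube h12 h2 x)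

/-- The representative is globally `C²`. [folklore] -/
theorem contDiff_expJacRep (e : ↥s × Fin 3 ≃ Fin n) {S₁ S₂ : ℝ} (h12 : S₁ < S₂) (h2 : 0 ≤ S₂)
    (hS₂π : 3 * S₂ ^ 2 < π ^ 2) : ContDiff ℝ 2 (expJacRep s e S₁ S₂) := by
  refine contDiff_iff_contDiffAt.2 fun x => ?_
  have hg : ContDiffAt ℝ 2 (expJac s e) (satMap S₁ S₂ x) :=
    (contDiffOn_expJac e).contDiffAt ((isOpen_chartDom e).mem_nhds (satMap_mem_chartDom e h12 h2 hS₂π x))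
  exact hg.comp x (contDiff_satMap S₁ S₂ (m := 2)).contDiffAt

/-- **The Hessian floor `2/3` of the exponential-chart Jacobian** (through its representative): for
`S' < S₁ < S₂`, `0 ≤ S₂`, `3 S₂² < π²`:
`HessianBoundOn (expJacRep s e S₁ S₂) (cube n S') (2/3)`. [folklore] -/
theorem hessianBoundOn_expJacRep (e : ↥s × Fin 3 ≃ Fin n) {S' S₁ S₂ : ℝ} (h01 : S' < S₁)
    (h12 : S₁ < S₂) (h2 : 0 ≤ S₂) (hS₂π : 3 * S₂ ^ 2 < π ^ 2) :
    HessianBoundOn (expJacRep s e S₁ S₂) (cube n S') (2 / 3) := by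
  have hf := contDiff_expJacRep e h12 h2 hS₂π
  have hsub : openCube n S₁ ⊆ chartDom s e := fun x hx =>
    cube_subset_chartDom e hS₂π (mem_cube_iff.2 fun i => ((mem_openCube_iff.1 hx i).trans h12).le)
  have hconv : ConvexOn ℝ (openCube n S₁)
      (fun x => expJacRep s e S₁ S₂ x - (2 / 3) / 2 * (x ⬝ᵥ x)) := by
    refine ((convexOn_expJac_sub e).subset hsub convex_openCube).congr fun x hx => ?_
    show expJac s e x - 1 / 3 * (x ⬝ᵥ x) = expJacRep s e S₁ S₂ x - (2 / 3) / 2 * (x ⬝ᵥ x)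
    rw [expJacRep_eq e h12 (openCube_subset_cube hx)]
    ring
  exact (hessianBoundOn_of_convexOn hf isOpen_openCube hconv).mono (cube_subset_openCube h01)

/-- The representative plus a `C²` function with Hessian `≥ μ` on `cube n S'` has Hessian `≥ 2/3 + μ` there.
[folklore] -/
theorem hessianBoundOn_expJacRep_add (e : ↥s × Fin 3 ≃ Fin n) {S' S₁ S₂ : ℝ} (h01 : S' < S₁)
    (h12 : S₁ < S₂) (h2 : 0 ≤ S₂) (hS₂π : 3 * S₂ ^ 2 < π ^ 2) {g : (Fin n → ℝ) → ℝ}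
    (hg : ContDiff ℝ 2 g) {mu : ℝ} (hB : HessianBoundOn g (cube n S') mu) :
    HessianBoundOn (fun x => expJacRep s e S₁ S₂ x + g x) (cube n S') (2 / 3 + mu) :=
  hessianBoundOn_add (contDiff_expJacRep e h12 h2 hS₂π) hg (hessianBoundOn_expJacRep e h01 h12 h2 hS₂π) hB

variable [DecidableEq (PBond P j)]

/-- The chart radius `π/√3` (as `√(π²/3)`). [folklore] -/
def radX : ℝ := Real.sqrt (π ^ 2 / 3)

/-- `π/√3 > 0`. [folklore] -/
theorem radX_pos : 0 < radX := Real.sqrt_pos.2 (by positivity)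

/-- `(π/√3)² = π²/3`. [folklore] -/
theorem radX_sq : radX ^ 2 = π ^ 2 / 3 := Real.sq_sqrt (by positivity)

/-- `3S² < π²` implies `S < π/√3`. [folklore] -/
theorem lt_radX_of_sq {S : ℝ} (h : 3 * S ^ 2 < π ^ 2) : S < radX :=
  lt_of_pow_lt_pow_left₀ 2 radX_pos.le (by rw [radX_sq]; linarith)

/-- `0 ≤ S < π/√3` implies `3S² < π²`. [folklore] -/
theorem three_mul_sq_lt_of_lt_radX {S : ℝ} (hS : 0 ≤ S) (h : S < radX) : 3 * S ^ 2 < π ^ 2 := by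
  have h2 : S ^ 2 < radX ^ 2 := pow_lt_pow_left₀ h hS two_ne_zero
  rw [radX_sq] at h2
  linarith

/-- **The local tilt/response plug for the exponential chart** — the twin of
`T4CubeConvexExtension.mem_respDom_of_gnoChart_local`: supply `C²` functions `g₀, g₁` agreeing on
`cube n S` with the tilt terms `−h(ι_{u₀}(Φ x))`, `−h(ι_u(Φ x))` (`Φ = expFibreChart`), with Hessians
`≥ μ` on a slightly larger cube `cube n S'`, `3 S'² < π²`, `2/3 + μ > 0`, and the response bound follows
with modulus `2/3 + μ` — the `2/3` being the Hessian floor of the chart Jacobian proved above. [folklore] -/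
theorem mem_respDom_of_expChart_local {β : Type*} (e : ↥s × Fin 3 ≃ Fin n) {u₀ : GaugeField P j SU2}
    {S : ℝ} (hS : 0 < S) {S' : ℝ} (hSS' : S < S') (hS'π : 3 * S' ^ 2 < π ^ 2)
    {h : Density P j SU2} (hhm : Measurable h) {C : ℝ}
    (hC : ∀ U, expWindowDensity s u₀ S U * Real.exp (h U) ≤ C) {u : GaugeField P j SU2} {K : ℝ}
    (hK : ∀ y : ↥s → SU2, |h (updateFinset u₀ s y) - h (updateFinset u s y)| ≤ K)
    {dev : GaugeField P j SU2 → ℝ} (hdev : 0 ≤ dev u) {mu : ℝ} (hlam : 0 < 2 / 3 + mu)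
    {g₀ g₁ : (Fin n → ℝ) → ℝ} (hg₀ : ContDiff ℝ 2 g₀) (hg₁ : ContDiff ℝ 2 g₁)
    (hB₀ : HessianBoundOn g₀ (cube n S') mu) (hB₁ : HessianBoundOn g₁ (cube n S') mu)
    (agree₀ : ∀ x ∈ cube n S, g₀ x = -h (updateFinset u₀ s (expFibreChart s u₀ e x)))
    (agree₁ : ∀ x ∈ cube n S, g₁ x = -h (updateFinset u s (expFibreChart s u₀ e x))) {bH : ℝ}
    (hgap : ∀ x ∈ cube n S,
      coordGradient (fun x => g₁ x - g₀ x) x ⬝ᵥ coordGradient (fun x => g₁ x - g₀ x) x ≤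
        (bH * dev u) ^ 2)
    {B : (↥s → SU2) → β → ℝ} {T : Finset β} (hBm : ∀ b ∈ T, Measurable fun y => B y b) {L : ℝ}
    (hBg : ∀ b ∈ T, ∃ g : (Fin n → ℝ) → ℝ, ContDiff ℝ 1 g ∧
      (∀ x ∈ cube n S, g x = B (expFibreChart s u₀ e x) b) ∧
      ∀ x ∈ cube n S, coordGradient g x ⬝ᵥ coordGradient g x ≤ L ^ 2) :
    u ∈ respDom s (expWindowDensity s u₀ S) h u₀ B T dev (bH / Real.sqrt (2 / 3 + mu))
      (L / Real.sqrt (2 / 3 + mu)) := by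
  have hSπ : 3 * S ^ 2 < π ^ 2 := by nlinarith
  have hm : S' < radX := lt_radX_of_sq hS'π
  -- two intermediate radii `S' < S₁ < S₂ < π/√3`
  obtain ⟨S₁, S₂, h01, h12, h2, hS₂π⟩ :
      ∃ S₁ S₂ : ℝ, S' < S₁ ∧ S₁ < S₂ ∧ 0 ≤ S₂ ∧ 3 * S₂ ^ 2 < π ^ 2 :=
    ⟨(2 * S' + radX) / 3, (S' + 2 * radX) / 3, by linarith, by linarith, by linarith,
      three_mul_sq_lt_of_lt_radX (by linarith) (by linarith)⟩
  have hfg : (fun x => expJacRep s e S₁ S₂ x + g₁ x - (expJacRep s e S₁ S₂ x + g₀ x)) =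
      fun x => g₁ x - g₀ x := funext fun x => by ring
  have hSS₁ : S ≤ S₁ := (hSS'.trans h01).le
  refine mem_respDom_of_cubeChart_local (f₀ := fun x => expJacRep s e S₁ S₂ x + g₀ x)
    (f₁ := fun x => expJacRep s e S₁ S₂ x + g₁ x)
    (cubeChart_specialUnitaryTwo_exp s u₀ e hS hSπ) (measurable_expWindowDensity s u₀ S) hhm
    expWindowDensity_nonneg hC (expWindowDensity_blind u) hK hdev hlam hSS'
    ((contDiff_expJacRep e h12 h2 hS₂π).add hg₀) ((contDiff_expJacRep e h12 h2 hS₂π).add hg₁)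
    (hessianBoundOn_expJacRep_add e h01 h12 h2 hS₂π hg₀ hB₀)
    (hessianBoundOn_expJacRep_add e h01 h12 h2 hS₂π hg₁ hB₁)
    (fun x hx => ?_) (fun x hx => ?_) (fun x hx => ?_) hBm hBg
  · show expJacRep s e S₁ S₂ x + g₀ x = _
    rw [agree₀ x hx, expJacRep_eq e h12 (cube_subset_cube hSS₁ hx)]
    ring
  · show expJacRep s e S₁ S₂ x + g₁ x = _
    rw [agree₁ x hx, expJacRep_eq e h12 (cube_subset_cube hSS₁ hx)]
    ring
  · show coordGradient (fun y => expJacRep s e S₁ S₂ y + g₁ y - (expJacRep s e S₁ S₂ y + g₀ y)) x ⬝ᵥ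
        coordGradient (fun y => expJacRep s e S₁ S₂ y + g₁ y - (expJacRep s e S₁ S₂ y + g₀ y)) x ≤
        (bH * dev u) ^ 2
    rw [hfg]
    exact hgap x hx

end Literature.MathematicalPhysics.QuantumFieldTheory.Balaban1983to89.T4CubeChartExpHessian
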